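import Summits.HodgeConjecture.HodgeConjecture.Theorems.Ring2WeilCoverageWeilGramLevel15
import HarnessLib

/-!
# Weil-type family coverage — THE COMPONENTS OF THE WEIL-TYPE `ℤ[ζ₁₅]`-FOURFOLDS, II: `K_d = ℚ(√−3)`, the types
# `𝔮₅` (degree `5`) and `𝔮₃` (degree `9`): Gram determinants `720 = 5·12²` and `1296 = 36²` — the type-`𝔮₅` polarised
# points lie on the NON-SPLIT component `(2, ℚ(√−3), [5])` (`T = {3,5}`, row W4.3.5), the type-`𝔮₃` ones on the SPLIT one

research route conditional on HC_CM; not a corollary; Q11.4-sentence-2 already refuted in dim ≥ 3.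

Ring 2, WEIL-TYPE FAMILY-COVERAGE CENSUS (`HOME/WEIL-FAMILY-COVERAGE.md` `## b01`, blocks b01.41 (C) and b01.46 (C2):
«S-PENCIL … the Weil-type `ℤ[ζ₁₅]`-fourfolds carry `ι`-compatible polarisations of type `𝔮₅` (degree `5`) and `𝔮₃`
(degree `9`) … they sit on the NON-SPLIT rows W4.3.5 … and on the SPLIT rows with the degree-`9` one», owner
ring2-b01), part 84 of the `Ring2WeilCoverage*` series; continues part 83 (frame `θ^i`, `θ = ζ + ζ⁻¹`; `s₃ = 1 + 2ζ⁵`).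
Part 80 (`Ring2WeilCoverageRamifiedTypesLevel15`) proved that every `ℚ(√−3)`-balanced CM type `Φ` of `ℚ(ζ₁₅)` carries
a `Φ`-positive divisor of type `𝔣₀` with `𝔬𝔣₀ = (π₅)`, `π₅ = ζ¹³(1 − ζ³)(1 − ζ)` (`(𝔬𝔣₀)⁴ = (5)`) and one with
`𝔬𝔣₀ = (π₃)`, `π₃ = ζ¹²(1 − ζ⁵)(1 − ζ)` (`(𝔬𝔣₀)² = (3)`).  Here:

* §1–§2 the traces `Tr(πξ s₃ θ^m)`, `m ≤ 6`, `π = π₅, π₃`, hence the Gram data of `(E_{πξ}, s₃)` in the frame `θ^i`: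
  **`det a(π₅ξ) = 720 = 5·12²`, `det a(π₃ξ) = 1296 = 36²`** (`= N_{K⁺/ℚ}(π)·det a(ξ) = (−5)(−144)`, `(−9)(−144)`:
  part 82's component rule in numbers).
* §3 **for EVERY skew `ζ′` of type `𝔮₅` (resp. `𝔮₃`) on `ℤ[ζ₁₅]` the determinant is `720` (resp. `1296`)** (part 82
  `det_realPart_eq_of_isOfType` + THEOREM L (i) at `15`; part 80 gives the `Φ`-positive ones on every balanced `Φ`).
* §4 classes: **`[720] = [5] ≠ [1]`** in `ℚˣ/Nm(ℚ(√−3)ˣ)` (`5` inert; `T(5) = {3, 5}`): the type-`𝔮₅` polarised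
  Weil-type `ℤ[ζ₁₅]`-points lie on the NON-SPLIT row **W4.3.5** `= (2, ℚ(√−3), 5)` of b01.2; **`[1296] = [1]`**: the
  type-`𝔮₃` ones on the SPLIT row W4.3.1 — b01.46 (C2)'s S-pencil placements as kernel theorems (right sign
  `(−1)² det > 0`, [vG94 5.2 (4)]).

HONEST FRAMING as parts 82/83: statements about traces in `ℚ(ζ₁₅)` and the rational Gram matrices of part 82; the row
labels are the census's reading of the class `[det a]` ([vG94 Lemma 5.2 (3), (5.4.1)]); nothing about Hodge classes,
`W_K`, general members or HC; `HC_CM` is used nowhere.  No `def`, no named fact, no `sorry`.  Certificates from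
`work/py/gen15.py` (exact arithmetic in `ℚ[x]/Φ₁₅`), re-verified by `linear_combination`.

References: [cite: vanGeemen1994HodgeAV, Lemma 5.2 (2)–(4), 5.4 and (5.4.1)]; [cite: Shimura1998, §14.3 Prop. 4–5,
pp. 103–104]; [cite: Serre1973, Ch. III §1] (Hilbert symbols); census b01.41 (C), b01.46 (C2) (seat-derived).
-/

noncomputable section

open Polynomial NumberField Module
open scoped nonZeroDivisors

namespace Summit.HodgeConjecture.Ring2WeilCoverage.WeilGramLevel15TypesSqrtNegThree

open Literature.AlgebraicGeometry.VanGeemen1994 (weilField weilNormResidueGroup)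
open Literature.AlgebraicGeometry.Motives (CMType normUnitsSubgroup)
open Literature.NumberTheory.ComplexMultiplication
open Summit.HodgeConjecture.Ring2WeilCoverage.WeilGramCMPoint
open Summit.HodgeConjecture.Ring2WeilCoverage.WeilGramLevel15
open Summit.HodgeConjecture.Ring2WeilCoverage.RealUnitNormHalfSystems (complexConj_eq_inv)
open Summit.HodgeConjecture.Ring2WeilCoverage.CyclotomicDifferent (isOfType_one_xi_top xi_ne_zero)
open Summit.HodgeConjecture.Ring2WeilCoverage.RamifiedTypes (isOfType_one_gen_mul_xi complexConj_gen_mul_xi gen_ne_zero)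
open Summit.HodgeConjecture.Ring2WeilCoverage.RamifiedTypesLevel15
open Summit.HodgeConjecture.Ring2WeilCoverage.RealUnitNormAllLevels (norm_realUnits_pos_fifteen)
open Summit.HodgeConjecture.HodgeConjecture.Ring2.WeilCoverage (mk_ne_split_of_even mk_eq_split_of_even
  natCast_not_mem_normUnitsSubgroup_of_inert natCast_not_mem_normUnitsSubgroup_of_ramified
  not_mem_normUnitsSubgroup_of_not_exists mem_normUnitsSubgroup_of_sq_add_mul_sq)
open Summit.HodgeConjecture.HodgeConjecture.Ring2.Hypotheses (splitDiscriminantClass)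

variable {K : Type} [Field K] [NumberField K] {ζ : K}

/-! ### §1 Type `𝔮₅`: `ζ′ = π₅ξ`, `π₅ = ζ¹³(1 − ζ³)(1 − ζ)` — `det a = 720` -/

/-- `Tr(ζ′sθ^0) = -4` for `ζ′ = π₅ξ, π₅ = ζ¹³(1 − ζ³)(1 − ζ)`, `s = √−3 = 1 + 2ζ⁵`, `θ = ζ + ζ⁻¹` (Euler evaluation). research route conditional on HC_CM; not a corollary; Q11.4-sentence-2 already refuted in dim ≥ 3. [folklore] -/
theorem trace_piFive_sqrtNegThree_zero [IsCyclotomicExtension {15} ℚ K] (hζ : IsPrimitiveRoot ζ 15) :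
    Algebra.trace ℚ K ((ζ ^ 13 * (1 - ζ ^ 3) * (1 - ζ) * (ζ ^ 3 * (aeval ζ (derivative (cyclotomic 15 ℚ)))⁻¹)) * (1 + 2 * ζ ^ 5)) = -4 := by
  have h15 : ζ ^ 15 = 1 := hζ.pow_eq_one
  have hΦ := cyc_fifteen hζ
  rw [trace_of_key₀ hζ (C (1 : ℚ) * X + C (-3 : ℚ) * X ^ 2 + C (2 : ℚ) * X ^ 3 + C (-1 : ℚ) * X ^ 4 + C (-1 : ℚ) * X ^ 5 +
      C (4 : ℚ) * X ^ 6 + C (-4 : ℚ) * X ^ 7) (by compute_degree) (by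
    simp only [map_add, map_mul, map_pow, aeval_C, aeval_X, map_neg, eq_ratCast, Rat.cast_ofNat]
    linear_combination ((aeval ζ (derivative (cyclotomic 15 ℚ)))⁻¹ * (2 * ζ^2)) * hΦ +
      ((aeval ζ (derivative (cyclotomic 15 ℚ)))⁻¹ * (ζ - ζ^2 - ζ^4 + ζ^5 + 2 * ζ^6 - 2 * ζ^7 - 2 * ζ^9 +
        2 * ζ^10)) * h15)]
  norm_num [coeff_X_pow, coeff_X, coeff_C]

/-- `Tr(ζ′sθ^1) = 0` for `ζ′ = π₅ξ, π₅ = ζ¹³(1 − ζ³)(1 − ζ)`, `s = √−3 = 1 + 2ζ⁵`, `θ = ζ + ζ⁻¹` (Euler evaluation). research route conditional on HC_CM; not a corollary; Q11.4-sentence-2 already refuted in dim ≥ 3. [folklore] -/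
theorem trace_piFive_sqrtNegThree_one [IsCyclotomicExtension {15} ℚ K] (hζ : IsPrimitiveRoot ζ 15) :
    Algebra.trace ℚ K ((ζ ^ 13 * (1 - ζ ^ 3) * (1 - ζ) * (ζ ^ 3 * (aeval ζ (derivative (cyclotomic 15 ℚ)))⁻¹)) * (1 + 2 * ζ ^ 5) * (ζ + ζ⁻¹)) = 0 := by
  have h15 : ζ ^ 15 = 1 := hζ.pow_eq_one
  have hΦ := cyc_fifteen hζ
  rw [trace_of_key₁ hζ (C (5 : ℚ) + C (-7 : ℚ) * X + C (3 : ℚ) * X ^ 2 + C (-3 : ℚ) * X ^ 4 + C (7 : ℚ) * X ^ 5 +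
      C (-5 : ℚ) * X ^ 6 + C (0 : ℚ) * X ^ 7) (by compute_degree) (by
    simp only [map_add, map_mul, map_pow, aeval_C, aeval_X, map_neg, eq_ratCast, Rat.cast_ofNat]
    linear_combination ((aeval ζ (derivative (cyclotomic 15 ℚ)))⁻¹ * (-4 * ζ + 2 * ζ^2 + 2 * ζ^4)) * hΦ +
      ((aeval ζ (derivative (cyclotomic 15 ℚ)))⁻¹ * (ζ - ζ^2 + ζ^3 - 2 * ζ^4 + ζ^5 + ζ^6 - ζ^7 +
        2 * ζ^8 - 4 * ζ^9 + 2 * ζ^10 - 2 * ζ^11 + 2 * ζ^12)) * h15)]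
  norm_num [coeff_X_pow, coeff_X, coeff_C]

/-- `Tr(ζ′sθ^2) = -10` for `ζ′ = π₅ξ, π₅ = ζ¹³(1 − ζ³)(1 − ζ)`, `s = √−3 = 1 + 2ζ⁵`, `θ = ζ + ζ⁻¹` (Euler evaluation). research route conditional on HC_CM; not a corollary; Q11.4-sentence-2 already refuted in dim ≥ 3. [folklore] -/
theorem trace_piFive_sqrtNegThree_two [IsCyclotomicExtension {15} ℚ K] (hζ : IsPrimitiveRoot ζ 15) :
    Algebra.trace ℚ K ((ζ ^ 13 * (1 - ζ ^ 3) * (1 - ζ) * (ζ ^ 3 * (aeval ζ (derivative (cyclotomic 15 ℚ)))⁻¹)) * (1 + 2 * ζ ^ 5) * (ζ + ζ⁻¹) ^ 2) = -10 := by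
  have h15 : ζ ^ 15 = 1 := hζ.pow_eq_one
  have hΦ := cyc_fifteen hζ
  rw [trace_of_key hζ (C (-2 : ℚ) + C (8 : ℚ) * X + C (-12 : ℚ) * X ^ 2 + C (5 : ℚ) * X ^ 3 + C (2 : ℚ) * X ^ 4 +
      C (-8 : ℚ) * X ^ 5 + C (12 : ℚ) * X ^ 6 + C (-10 : ℚ) * X ^ 7) (by compute_degree) (by
    simp only [map_add, map_mul, map_pow, aeval_C, aeval_X, map_neg, eq_ratCast, Rat.cast_ofNat]
    linear_combination ((aeval ζ (derivative (cyclotomic 15 ℚ)))⁻¹ * (ζ + 2 * ζ^2 - 4 * ζ^3 + 4 * ζ^4 + 2 * ζ^6)) * hΦ +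
      ((aeval ζ (derivative (cyclotomic 15 ℚ)))⁻¹ * (ζ - ζ^2 + 2 * ζ^3 - 3 * ζ^4 + 2 * ζ^5 - ζ^6 +
        3 * ζ^8 - 5 * ζ^9 + 4 * ζ^10 - 6 * ζ^11 + 4 * ζ^12 - 2 * ζ^13 + 2 * ζ^14)) * h15)]
  norm_num [coeff_X_pow, coeff_X, coeff_C]

/-- `Tr(ζ′sθ^3) = 4` for `ζ′ = π₅ξ, π₅ = ζ¹³(1 − ζ³)(1 − ζ)`, `s = √−3 = 1 + 2ζ⁵`, `θ = ζ + ζ⁻¹` (Euler evaluation). research route conditional on HC_CM; not a corollary; Q11.4-sentence-2 already refuted in dim ≥ 3. [folklore] -/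
theorem trace_piFive_sqrtNegThree_three [IsCyclotomicExtension {15} ℚ K] (hζ : IsPrimitiveRoot ζ 15) :
    Algebra.trace ℚ K ((ζ ^ 13 * (1 - ζ ^ 3) * (1 - ζ) * (ζ ^ 3 * (aeval ζ (derivative (cyclotomic 15 ℚ)))⁻¹)) * (1 + 2 * ζ ^ 5) * (ζ + ζ⁻¹) ^ 3) = 4 := by
  have h15 : ζ ^ 15 = 1 := hζ.pow_eq_one
  have hΦ := cyc_fifteen hζ
  rw [trace_of_key hζ (C (16 : ℚ) + C (-24 : ℚ) * X + C (15 : ℚ) * X ^ 2 + C (-2 : ℚ) * X ^ 3 + C (-11 : ℚ) * X ^ 4 +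
      C (24 : ℚ) * X ^ 5 + C (-20 : ℚ) * X ^ 6 + C (4 : ℚ) * X ^ 7) (by compute_degree) (by
    simp only [map_add, map_mul, map_pow, aeval_C, aeval_X, map_neg, eq_ratCast, Rat.cast_ofNat]
    linear_combination ((aeval ζ (derivative (cyclotomic 15 ℚ)))⁻¹ * (-2 + ζ - 11 * ζ^3 + 6 * ζ^4 - 2 * ζ^5 + 6 * ζ^6)) * hΦ +
      ((aeval ζ (derivative (cyclotomic 15 ℚ)))⁻¹ * (-2 + 3 * ζ - ζ^2 + 3 * ζ^3 - 4 * ζ^4 + 4 * ζ^5 - 4 * ζ^6 +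
        2 * ζ^7 + 2 * ζ^8 - 5 * ζ^9 + 7 * ζ^10 - 11 * ζ^11 + 8 * ζ^12 - 8 * ζ^13 + 6 * ζ^14 - 2 * ζ^15 +
        2 * ζ^16)) * h15)]
  norm_num [coeff_X_pow, coeff_X, coeff_C]

/-- `Tr(ζ′sθ^4) = -32` for `ζ′ = π₅ξ, π₅ = ζ¹³(1 − ζ³)(1 − ζ)`, `s = √−3 = 1 + 2ζ⁵`, `θ = ζ + ζ⁻¹` (Euler evaluation). research route conditional on HC_CM; not a corollary; Q11.4-sentence-2 already refuted in dim ≥ 3. [folklore] -/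
theorem trace_piFive_sqrtNegThree_four [IsCyclotomicExtension {15} ℚ K] (hζ : IsPrimitiveRoot ζ 15) :
    Algebra.trace ℚ K ((ζ ^ 13 * (1 - ζ ^ 3) * (1 - ζ) * (ζ ^ 3 * (aeval ζ (derivative (cyclotomic 15 ℚ)))⁻¹)) * (1 + 2 * ζ ^ 5) * (ζ + ζ⁻¹) ^ 4) = -32 := by
  have h15 : ζ ^ 15 = 1 := hζ.pow_eq_one
  have hΦ := cyc_fifteen hζ
  rw [trace_of_key hζ (C (-12 : ℚ) + C (35 : ℚ) * X + C (-42 : ℚ) * X ^ 2 + C (16 : ℚ) * X ^ 3 + C (10 : ℚ) * X ^ 4 +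
      C (-35 : ℚ) * X ^ 5 + C (44 : ℚ) * X ^ 6 + C (-32 : ℚ) * X ^ 7) (by compute_degree) (by
    simp only [map_add, map_mul, map_pow, aeval_C, aeval_X, map_neg, eq_ratCast, Rat.cast_ofNat]
    linear_combination ((aeval ζ (derivative (cyclotomic 15 ℚ)))⁻¹ * (-10 - ζ - 4 * ζ^2 + 12 * ζ^3 + 10 * ζ^4 - 5 * ζ^5 +
        14 * ζ^6)) * hΦ +
      ((aeval ζ (derivative (cyclotomic 15 ℚ)))⁻¹ * (-10 + 9 * ζ - 3 * ζ^2 + 6 * ζ^3 - 5 * ζ^4 +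
        7 * ζ^5 - 8 * ζ^6 + 6 * ζ^7 - 2 * ζ^8 - 3 * ζ^9 + 9 * ζ^10 - 16 * ζ^11 + 15 * ζ^12 - 19 * ζ^13 +
        14 * ζ^14 - 10 * ζ^15 + 8 * ζ^16 - 2 * ζ^17 + 2 * ζ^18)) * h15)]
  norm_num [coeff_X_pow, coeff_X, coeff_C]

/-- `Tr(ζ′sθ^5) = 24` for `ζ′ = π₅ξ, π₅ = ζ¹³(1 − ζ³)(1 − ζ)`, `s = √−3 = 1 + 2ζ⁵`, `θ = ζ + ζ⁻¹` (Euler evaluation). research route conditional on HC_CM; not a corollary; Q11.4-sentence-2 already refuted in dim ≥ 3. [folklore] -/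
theorem trace_piFive_sqrtNegThree_five [IsCyclotomicExtension {15} ℚ K] (hζ : IsPrimitiveRoot ζ 15) :
    Algebra.trace ℚ K ((ζ ^ 13 * (1 - ζ ^ 3) * (1 - ζ) * (ζ ^ 3 * (aeval ζ (derivative (cyclotomic 15 ℚ)))⁻¹)) * (1 + 2 * ζ ^ 5) * (ζ + ζ⁻¹) ^ 5) = 24 := by
  have h15 : ζ ^ 15 = 1 := hζ.pow_eq_one
  have hΦ := cyc_fifteen hζ
  rw [trace_of_key hζ (C (55 : ℚ) + C (-86 : ℚ) * X + C (63 : ℚ) * X ^ 2 + C (-12 : ℚ) * X ^ 3 + C (-39 : ℚ) * X ^ 4 +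
      C (86 : ℚ) * X ^ 5 + C (-79 : ℚ) * X ^ 6 + C (24 : ℚ) * X ^ 7) (by compute_degree) (by
    simp only [map_add, map_mul, map_pow, aeval_C, aeval_X, map_neg, eq_ratCast, Rat.cast_ofNat]
    linear_combination ((aeval ζ (derivative (cyclotomic 15 ℚ)))⁻¹ * (-29 - 6 * ζ - 19 * ζ^2 + 25 * ζ^3 - 6 * ζ^4 - 6 * ζ^5 +
        29 * ζ^6)) * hΦ +
      ((aeval ζ (derivative (cyclotomic 15 ℚ)))⁻¹ * (-29 + 23 * ζ - 13 * ζ^2 + 15 * ζ^3 - 8 * ζ^4 +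
        13 * ζ^5 - 13 * ζ^6 + 13 * ζ^7 - 10 * ζ^8 + 3 * ζ^9 + 7 * ζ^10 - 19 * ζ^11 + 24 * ζ^12 - 35 * ζ^13 +
        29 * ζ^14 - 29 * ζ^15 + 22 * ζ^16 - 12 * ζ^17 + 10 * ζ^18 - 2 * ζ^19 + 2 * ζ^20)) * h15)]
  norm_num [coeff_X_pow, coeff_X, coeff_C]

/-- `Tr(ζ′sθ^6) = -110` for `ζ′ = π₅ξ, π₅ = ζ¹³(1 − ζ³)(1 − ζ)`, `s = √−3 = 1 + 2ζ⁵`, `θ = ζ + ζ⁻¹` (Euler evaluation). research route conditional on HC_CM; not a corollary; Q11.4-sentence-2 already refuted in dim ≥ 3. [folklore] -/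
theorem trace_piFive_sqrtNegThree_six [IsCyclotomicExtension {15} ℚ K] (hζ : IsPrimitiveRoot ζ 15) :
    Algebra.trace ℚ K ((ζ ^ 13 * (1 - ζ ^ 3) * (1 - ζ) * (ζ ^ 3 * (aeval ζ (derivative (cyclotomic 15 ℚ)))⁻¹)) * (1 + 2 * ζ ^ 5) * (ζ + ζ⁻¹) ^ 6) = -110 := by
  have h15 : ζ ^ 15 = 1 := hζ.pow_eq_one
  have hΦ := cyc_fifteen hζ
  rw [trace_of_key hζ (C (-55 : ℚ) + C (142 : ℚ) * X + C (-153 : ℚ) * X ^ 2 + C (55 : ℚ) * X ^ 3 + C (43 : ℚ) * X ^ 4 +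
      C (-142 : ℚ) * X ^ 5 + C (165 : ℚ) * X ^ 6 + C (-110 : ℚ) * X ^ 7) (by compute_degree) (by
    simp only [map_add, map_mul, map_pow, aeval_C, aeval_X, map_neg, eq_ratCast, Rat.cast_ofNat]
    linear_combination ((aeval ζ (derivative (cyclotomic 15 ℚ)))⁻¹ * (-64 - 12 * ζ - 54 * ζ^2 + 48 * ζ^3 - 25 * ζ^4 + 109 * ζ^5 +
        53 * ζ^6)) * hΦ +
      ((aeval ζ (derivative (cyclotomic 15 ℚ)))⁻¹ * (-64 + 52 * ζ - 42 * ζ^2 + 38 * ζ^3 - 21 * ζ^4 +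
        28 * ζ^5 - 21 * ζ^6 + 26 * ζ^7 - 23 * ζ^8 + 16 * ζ^9 - 3 * ζ^10 - 16 * ζ^11 + 31 * ζ^12 - 54 * ζ^13 +
        53 * ζ^14 - 64 * ζ^15 + 51 * ζ^16 - 41 * ζ^17 + 32 * ζ^18 - 14 * ζ^19 + 12 * ζ^20 - 2 * ζ^21 +
        2 * ζ^22)) * h15)]
  norm_num [coeff_X_pow, coeff_X, coeff_C]

/-- **The Gram datum `a` of `(E_ζ′, s)` in the real frame `θ^i` (`i < 4`)** for `ζ′ = π₅ξ, π₅ = ζ¹³(1 − ζ³)(1 − ζ)` (type 𝔮₅ ((𝔬𝔣₀)⁴ = (5))),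
`s = √−3 = 1 + 2ζ⁵`: the integer Hankel matrix `(−Tr(ζ′sθ^{i+j}))ᵢⱼ` (and `b = 0`, part 82 `hb_eq_zero`).
research route conditional on HC_CM; not a corollary; Q11.4-sentence-2 already refuted in dim ≥ 3. [cite: vanGeemen1994HodgeAV, Lemma 5.2 (2)–(3)] -/
theorem realPart_piFive_sqrtNegThree [IsCyclotomicExtension {15} ℚ K] [IsCMField K] (hζ : IsPrimitiveRoot ζ 15)
    {x : Fin 4 → K} (hx : ∀ i, x i = (ζ + ζ⁻¹) ^ (i : ℕ)) {a : Matrix (Fin 4) (Fin 4) ℚ}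
    (ha : ∀ i j, a i j = Algebra.trace ℚ K ((ζ ^ 13 * (1 - ζ ^ 3) * (1 - ζ) * (ζ ^ 3 * (aeval ζ (derivative (cyclotomic 15 ℚ)))⁻¹)) * x i * IsCMField.complexConj K ((1 + 2 * ζ ^ 5) * x j))) :
    a = !![4, 0, 10, -4; 0, 10, -4, 32; 10, -4, 32, -24; -4, 32, -24, 110] := by
  rw [ha_eq (complexConj_sqrtNegThree hζ) (complexConj_thetaFrame hζ hx) ha]
  ext i j
  simp only [Matrix.of_apply, hx, ← pow_add]
  fin_cases i <;> fin_cases j <;> simp [trace_piFive_sqrtNegThree_zero hζ, trace_piFive_sqrtNegThree_one hζ, trace_piFive_sqrtNegThree_two hζ, trace_piFive_sqrtNegThree_three hζ, trace_piFive_sqrtNegThree_four hζ, trace_piFive_sqrtNegThree_five hζ, trace_piFive_sqrtNegThree_six hζ]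

/-- **`det a = 720`** for `ζ′ = π₅ξ, π₅ = ζ¹³(1 − ζ³)(1 − ζ)`, `s = √−3 = 1 + 2ζ⁵` (frame `θ^i`).
research route conditional on HC_CM; not a corollary; Q11.4-sentence-2 already refuted in dim ≥ 3. [cite: vanGeemen1994HodgeAV, Lemma 5.2 (3)] -/
theorem det_realPart_piFive_sqrtNegThree [IsCyclotomicExtension {15} ℚ K] [IsCMField K] (hζ : IsPrimitiveRoot ζ 15)
    {x : Fin 4 → K} (hx : ∀ i, x i = (ζ + ζ⁻¹) ^ (i : ℕ)) {a : Matrix (Fin 4) (Fin 4) ℚ}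
    (ha : ∀ i j, a i j = Algebra.trace ℚ K ((ζ ^ 13 * (1 - ζ ^ 3) * (1 - ζ) * (ζ ^ 3 * (aeval ζ (derivative (cyclotomic 15 ℚ)))⁻¹)) * x i * IsCMField.complexConj K ((1 + 2 * ζ ^ 5) * x j))) :
    a.det = 720 := by
  rw [realPart_piFive_sqrtNegThree hζ hx ha]
  simp [Matrix.det_succ_row_zero, Fin.sum_univ_succ, Fin.succAbove, Matrix.submatrix]
  norm_num

/-! ### §2 Type `𝔮₃`: `ζ′ = π₃ξ`, `π₃ = ζ¹²(1 − ζ⁵)(1 − ζ)` — `det a = 1296` -/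

/-- `Tr(ζ′sθ^0) = 0` for `ζ′ = π₃ξ, π₃ = ζ¹²(1 − ζ⁵)(1 − ζ)`, `s = √−3 = 1 + 2ζ⁵`, `θ = ζ + ζ⁻¹` (Euler evaluation). research route conditional on HC_CM; not a corollary; Q11.4-sentence-2 already refuted in dim ≥ 3. [folklore] -/
theorem trace_piThree_sqrtNegThree_zero [IsCyclotomicExtension {15} ℚ K] (hζ : IsPrimitiveRoot ζ 15) :
    Algebra.trace ℚ K ((ζ ^ 12 * (1 - ζ ^ 5) * (1 - ζ) * (ζ ^ 3 * (aeval ζ (derivative (cyclotomic 15 ℚ)))⁻¹)) * (1 + 2 * ζ ^ 5)) = 0 := by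
  have h15 : ζ ^ 15 = 1 := hζ.pow_eq_one
  have hΦ := cyc_fifteen hζ
  rw [trace_of_key₀ hζ (C (3 : ℚ) + C (-3 : ℚ) * X + C (3 : ℚ) * X ^ 5 + C (-3 : ℚ) * X ^ 6 + C (0 : ℚ) * X ^ 7) (by compute_degree) (by
    simp only [map_add, map_mul, map_pow, aeval_C, aeval_X, map_neg, eq_ratCast, Rat.cast_ofNat]
    linear_combination ((aeval ζ (derivative (cyclotomic 15 ℚ)))⁻¹ * (-2 + 2 * ζ^3)) * hΦ +
      ((aeval ζ (derivative (cyclotomic 15 ℚ)))⁻¹ * (1 - ζ + ζ^5 - ζ^6 - 2 * ζ^10 + 2 * ζ^11)) * h15)]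
  norm_num [coeff_X_pow, coeff_X, coeff_C]

/-- `Tr(ζ′sθ^1) = -6` for `ζ′ = π₃ξ, π₃ = ζ¹²(1 − ζ⁵)(1 − ζ)`, `s = √−3 = 1 + 2ζ⁵`, `θ = ζ + ζ⁻¹` (Euler evaluation). research route conditional on HC_CM; not a corollary; Q11.4-sentence-2 already refuted in dim ≥ 3. [folklore] -/
theorem trace_piThree_sqrtNegThree_one [IsCyclotomicExtension {15} ℚ K] (hζ : IsPrimitiveRoot ζ 15) :
    Algebra.trace ℚ K ((ζ ^ 12 * (1 - ζ ^ 5) * (1 - ζ) * (ζ ^ 3 * (aeval ζ (derivative (cyclotomic 15 ℚ)))⁻¹)) * (1 + 2 * ζ ^ 5) * (ζ + ζ⁻¹)) = -6 := by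
  have h15 : ζ ^ 15 = 1 := hζ.pow_eq_one
  have hΦ := cyc_fifteen hζ
  rw [trace_of_key₁ hζ (C (3 : ℚ) * X + C (-6 : ℚ) * X ^ 2 + C (3 : ℚ) * X ^ 3 + C (-3 : ℚ) * X ^ 5 + C (6 : ℚ) * X ^ 6 +
      C (-6 : ℚ) * X ^ 7) (by compute_degree) (by
    simp only [map_add, map_mul, map_pow, aeval_C, aeval_X, map_neg, eq_ratCast, Rat.cast_ofNat]
    linear_combination ((aeval ζ (derivative (cyclotomic 15 ℚ)))⁻¹ * (1 - 2 * ζ^2 + 2 * ζ^3 + 2 * ζ^5)) * hΦ +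
      ((aeval ζ (derivative (cyclotomic 15 ℚ)))⁻¹ * (1 - ζ + ζ^2 - ζ^3 + ζ^5 - ζ^6 + ζ^7 - ζ^8 - 2 * ζ^10 +
        2 * ζ^11 - 2 * ζ^12 + 2 * ζ^13)) * h15)]
  norm_num [coeff_X_pow, coeff_X, coeff_C]

/-- `Tr(ζ′sθ^2) = 0` for `ζ′ = π₃ξ, π₃ = ζ¹²(1 − ζ⁵)(1 − ζ)`, `s = √−3 = 1 + 2ζ⁵`, `θ = ζ + ζ⁻¹` (Euler evaluation). research route conditional on HC_CM; not a corollary; Q11.4-sentence-2 already refuted in dim ≥ 3. [folklore] -/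
theorem trace_piThree_sqrtNegThree_two [IsCyclotomicExtension {15} ℚ K] (hζ : IsPrimitiveRoot ζ 15) :
    Algebra.trace ℚ K ((ζ ^ 12 * (1 - ζ ^ 5) * (1 - ζ) * (ζ ^ 3 * (aeval ζ (derivative (cyclotomic 15 ℚ)))⁻¹)) * (1 + 2 * ζ ^ 5) * (ζ + ζ⁻¹) ^ 2) = 0 := by
  have h15 : ζ ^ 15 = 1 := hζ.pow_eq_one
  have hΦ := cyc_fifteen hζ
  rw [trace_of_key hζ (C (9 : ℚ) + C (-12 : ℚ) * X + C (6 : ℚ) * X ^ 2 + C (-6 : ℚ) * X ^ 4 + C (12 : ℚ) * X ^ 5 +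
      C (-9 : ℚ) * X ^ 6 + C (0 : ℚ) * X ^ 7) (by compute_degree) (by
    simp only [map_add, map_mul, map_pow, aeval_C, aeval_X, map_neg, eq_ratCast, Rat.cast_ofNat]
    linear_combination ((aeval ζ (derivative (cyclotomic 15 ℚ)))⁻¹ * (3 + 2 * ζ - 5 * ζ^2 + 2 * ζ^3 - 2 * ζ^4 +
        2 * ζ^5 - 2 * ζ^6)) * hΦ +
      ((aeval ζ (derivative (cyclotomic 15 ℚ)))⁻¹ * (3 - ζ + 2 * ζ^2 - 2 * ζ^3 + ζ^4 - ζ^6 + 2 * ζ^7 - 2 * ζ^8 +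
        ζ^9 - 3 * ζ^10 + 2 * ζ^11 - 4 * ζ^12 + 4 * ζ^13 - 2 * ζ^14 + 2 * ζ^15)) * h15)]
  norm_num [coeff_X_pow, coeff_X, coeff_C]

/-- `Tr(ζ′sθ^3) = -18` for `ζ′ = π₃ξ, π₃ = ζ¹²(1 − ζ⁵)(1 − ζ)`, `s = √−3 = 1 + 2ζ⁵`, `θ = ζ + ζ⁻¹` (Euler evaluation). research route conditional on HC_CM; not a corollary; Q11.4-sentence-2 already refuted in dim ≥ 3. [folklore] -/
theorem trace_piThree_sqrtNegThree_three [IsCyclotomicExtension {15} ℚ K] (hζ : IsPrimitiveRoot ζ 15) :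
    Algebra.trace ℚ K ((ζ ^ 12 * (1 - ζ ^ 5) * (1 - ζ) * (ζ ^ 3 * (aeval ζ (derivative (cyclotomic 15 ℚ)))⁻¹)) * (1 + 2 * ζ ^ 5) * (ζ + ζ⁻¹) ^ 3) = -18 := by
  have h15 : ζ ^ 15 = 1 := hζ.pow_eq_one
  have hΦ := cyc_fifteen hζ
  rw [trace_of_key hζ (C (-3 : ℚ) + C (15 : ℚ) * X + C (-21 : ℚ) * X ^ 2 + C (9 : ℚ) * X ^ 3 + C (3 : ℚ) * X ^ 4 +
      C (-15 : ℚ) * X ^ 5 + C (21 : ℚ) * X ^ 6 + C (-18 : ℚ) * X ^ 7) (by compute_degree) (by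
    simp only [map_add, map_mul, map_pow, aeval_C, aeval_X, map_neg, eq_ratCast, Rat.cast_ofNat]
    linear_combination ((aeval ζ (derivative (cyclotomic 15 ℚ)))⁻¹ * (7 + 4 * ζ + 9 * ζ^2 + 2 * ζ^3 - 7 * ζ^4 - 6 * ζ^6)) * hΦ +
      ((aeval ζ (derivative (cyclotomic 15 ℚ)))⁻¹ * (7 - 3 * ζ + 5 * ζ^2 - 3 * ζ^3 + 3 * ζ^4 - 2 * ζ^5 +
        2 * ζ^7 - 3 * ζ^8 + 3 * ζ^9 - 5 * ζ^10 + 3 * ζ^11 - 7 * ζ^12 + 6 * ζ^13 - 6 * ζ^14 + 6 * ζ^15 - 2 * ζ^16 +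
        2 * ζ^17)) * h15)]
  norm_num [coeff_X_pow, coeff_X, coeff_C]

/-- `Tr(ζ′sθ^4) = 6` for `ζ′ = π₃ξ, π₃ = ζ¹²(1 − ζ⁵)(1 − ζ)`, `s = √−3 = 1 + 2ζ⁵`, `θ = ζ + ζ⁻¹` (Euler evaluation). research route conditional on HC_CM; not a corollary; Q11.4-sentence-2 already refuted in dim ≥ 3. [folklore] -/
theorem trace_piThree_sqrtNegThree_four [IsCyclotomicExtension {15} ℚ K] (hζ : IsPrimitiveRoot ζ 15) :
    Algebra.trace ℚ K ((ζ ^ 12 * (1 - ζ ^ 5) * (1 - ζ) * (ζ ^ 3 * (aeval ζ (derivative (cyclotomic 15 ℚ)))⁻¹)) * (1 + 2 * ζ ^ 5) * (ζ + ζ⁻¹) ^ 4) = 6 := by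
  have h15 : ζ ^ 15 = 1 := hζ.pow_eq_one
  have hΦ := cyc_fifteen hζ
  rw [trace_of_key hζ (C (30 : ℚ) + C (-42 : ℚ) * X + C (27 : ℚ) * X ^ 2 + C (-3 : ℚ) * X ^ 3 + C (-21 : ℚ) * X ^ 4 +
      C (42 : ℚ) * X ^ 5 + C (-36 : ℚ) * X ^ 6 + C (6 : ℚ) * X ^ 7) (by compute_degree) (by
    simp only [map_add, map_mul, map_pow, aeval_C, aeval_X, map_neg, eq_ratCast, Rat.cast_ofNat]
    linear_combination ((aeval ζ (derivative (cyclotomic 15 ℚ)))⁻¹ * (13 + 4 * ζ +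
        16 * ζ^2 - 3 * ζ^3 - 16 * ζ^4 - 4 * ζ^5 - 13 * ζ^6)) * hΦ +
      ((aeval ζ (derivative (cyclotomic 15 ℚ)))⁻¹ * (13 - 9 * ζ + 12 * ζ^2 - 6 * ζ^3 + 8 * ζ^4 - 5 * ζ^5 +
        3 * ζ^6 - 3 * ζ^8 + 5 * ζ^9 - 8 * ζ^10 + 6 * ζ^11 - 12 * ζ^12 + 9 * ζ^13 - 13 * ζ^14 +
        12 * ζ^15 - 8 * ζ^16 + 8 * ζ^17 - 2 * ζ^18 + 2 * ζ^19)) * h15)]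
  norm_num [coeff_X_pow, coeff_X, coeff_C]

/-- `Tr(ζ′sθ^5) = -60` for `ζ′ = π₃ξ, π₃ = ζ¹²(1 − ζ⁵)(1 − ζ)`, `s = √−3 = 1 + 2ζ⁵`, `θ = ζ + ζ⁻¹` (Euler evaluation). research route conditional on HC_CM; not a corollary; Q11.4-sentence-2 already refuted in dim ≥ 3. [folklore] -/
theorem trace_piThree_sqrtNegThree_five [IsCyclotomicExtension {15} ℚ K] (hζ : IsPrimitiveRoot ζ 15) :
    Algebra.trace ℚ K ((ζ ^ 12 * (1 - ζ ^ 5) * (1 - ζ) * (ζ ^ 3 * (aeval ζ (derivative (cyclotomic 15 ℚ)))⁻¹)) * (1 + 2 * ζ ^ 5) * (ζ + ζ⁻¹) ^ 5) = -60 := by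
  have h15 : ζ ^ 15 = 1 := hζ.pow_eq_one
  have hΦ := cyc_fifteen hζ
  rw [trace_of_key hζ (C (-18 : ℚ) + C (63 : ℚ) * X + C (-75 : ℚ) * X ^ 2 + C (30 : ℚ) * X ^ 3 + C (15 : ℚ) * X ^ 4 +
      C (-63 : ℚ) * X ^ 5 + C (78 : ℚ) * X ^ 6 + C (-60 : ℚ) * X ^ 7) (by compute_degree) (by
    simp only [map_add, map_mul, map_pow, aeval_C, aeval_X, map_neg, eq_ratCast, Rat.cast_ofNat]
    linear_combination ((aeval ζ (derivative (cyclotomic 15 ℚ)))⁻¹ * (22 + 25 * ζ^2 - 12 * ζ^3 +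
        30 * ζ^4 - 10 * ζ^5 - 25 * ζ^6)) * hΦ +
      ((aeval ζ (derivative (cyclotomic 15 ℚ)))⁻¹ * (22 - 22 * ζ + 25 * ζ^2 - 15 * ζ^3 + 20 * ζ^4 - 11 * ζ^5 +
        11 * ζ^6 - 5 * ζ^7 + 5 * ζ^9 - 11 * ζ^10 + 11 * ζ^11 - 20 * ζ^12 + 15 * ζ^13 - 25 * ζ^14 +
        21 * ζ^15 - 21 * ζ^16 + 20 * ζ^17 - 10 * ζ^18 + 10 * ζ^19 - 2 * ζ^20 + 2 * ζ^21)) * h15)]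
  norm_num [coeff_X_pow, coeff_X, coeff_C]

/-- `Tr(ζ′sθ^6) = 36` for `ζ′ = π₃ξ, π₃ = ζ¹²(1 − ζ⁵)(1 − ζ)`, `s = √−3 = 1 + 2ζ⁵`, `θ = ζ + ζ⁻¹` (Euler evaluation). research route conditional on HC_CM; not a corollary; Q11.4-sentence-2 already refuted in dim ≥ 3. [folklore] -/
theorem trace_piThree_sqrtNegThree_six [IsCyclotomicExtension {15} ℚ K] (hζ : IsPrimitiveRoot ζ 15) :
    Algebra.trace ℚ K ((ζ ^ 12 * (1 - ζ ^ 5) * (1 - ζ) * (ζ ^ 3 * (aeval ζ (derivative (cyclotomic 15 ℚ)))⁻¹)) * (1 + 2 * ζ ^ 5) * (ζ + ζ⁻¹) ^ 6) = 36 := by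
  have h15 : ζ ^ 15 = 1 := hζ.pow_eq_one
  have hΦ := cyc_fifteen hζ
  rw [trace_of_key hζ (C (105 : ℚ) + C (-153 : ℚ) * X + C (111 : ℚ) * X ^ 2 + C (-18 : ℚ) * X ^ 3 + C (-75 : ℚ) * X ^ 4 +
      C (153 : ℚ) * X ^ 5 + C (-141 : ℚ) * X ^ 6 + C (36 : ℚ) * X ^ 7) (by compute_degree) (by
    simp only [map_add, map_mul, map_pow, aeval_C, aeval_X, map_neg, eq_ratCast, Rat.cast_ofNat]
    linear_combination ((aeval ζ (derivative (cyclotomic 15 ℚ)))⁻¹ * (37 - 10 * ζ + 37 * ζ^2 - 37 * ζ^3 +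
        55 * ζ^4 - 55 * ζ^5 - 45 * ζ^6)) * hΦ +
      ((aeval ζ (derivative (cyclotomic 15 ℚ)))⁻¹ * (37 - 47 * ζ + 47 * ζ^2 - 37 * ζ^3 + 45 * ζ^4 - 26 * ζ^5 +
        31 * ζ^6 - 16 * ζ^7 + 11 * ζ^8 - 11 * ζ^10 + 16 * ζ^11 - 31 * ζ^12 + 26 * ζ^13 - 45 * ζ^14 +
        36 * ζ^15 - 46 * ζ^16 + 41 * ζ^17 - 31 * ζ^18 + 30 * ζ^19 - 12 * ζ^20 + 12 * ζ^21 - 2 * ζ^22 +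
        2 * ζ^23)) * h15)]
  norm_num [coeff_X_pow, coeff_X, coeff_C]

/-- **The Gram datum `a` of `(E_ζ′, s)` in the real frame `θ^i` (`i < 4`)** for `ζ′ = π₃ξ, π₃ = ζ¹²(1 − ζ⁵)(1 − ζ)` (type 𝔮₃ ((𝔬𝔣₀)² = (3))),
`s = √−3 = 1 + 2ζ⁵`: the integer Hankel matrix `(−Tr(ζ′sθ^{i+j}))ᵢⱼ` (and `b = 0`, part 82 `hb_eq_zero`).
research route conditional on HC_CM; not a corollary; Q11.4-sentence-2 already refuted in dim ≥ 3. [cite: vanGeemen1994HodgeAV, Lemma 5.2 (2)–(3)] -/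
theorem realPart_piThree_sqrtNegThree [IsCyclotomicExtension {15} ℚ K] [IsCMField K] (hζ : IsPrimitiveRoot ζ 15)
    {x : Fin 4 → K} (hx : ∀ i, x i = (ζ + ζ⁻¹) ^ (i : ℕ)) {a : Matrix (Fin 4) (Fin 4) ℚ}
    (ha : ∀ i j, a i j = Algebra.trace ℚ K ((ζ ^ 12 * (1 - ζ ^ 5) * (1 - ζ) * (ζ ^ 3 * (aeval ζ (derivative (cyclotomic 15 ℚ)))⁻¹)) * x i * IsCMField.complexConj K ((1 + 2 * ζ ^ 5) * x j))) :
    a = !![0, 6, 0, 18; 6, 0, 18, -6; 0, 18, -6, 60; 18, -6, 60, -36] := by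
  rw [ha_eq (complexConj_sqrtNegThree hζ) (complexConj_thetaFrame hζ hx) ha]
  ext i j
  simp only [Matrix.of_apply, hx, ← pow_add]
  fin_cases i <;> fin_cases j <;> simp [trace_piThree_sqrtNegThree_zero hζ, trace_piThree_sqrtNegThree_one hζ, trace_piThree_sqrtNegThree_two hζ, trace_piThree_sqrtNegThree_three hζ, trace_piThree_sqrtNegThree_four hζ, trace_piThree_sqrtNegThree_five hζ, trace_piThree_sqrtNegThree_six hζ]

/-- **`det a = 1296`** for `ζ′ = π₃ξ, π₃ = ζ¹²(1 − ζ⁵)(1 − ζ)`, `s = √−3 = 1 + 2ζ⁵` (frame `θ^i`).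
research route conditional on HC_CM; not a corollary; Q11.4-sentence-2 already refuted in dim ≥ 3. [cite: vanGeemen1994HodgeAV, Lemma 5.2 (3)] -/
theorem det_realPart_piThree_sqrtNegThree [IsCyclotomicExtension {15} ℚ K] [IsCMField K] (hζ : IsPrimitiveRoot ζ 15)
    {x : Fin 4 → K} (hx : ∀ i, x i = (ζ + ζ⁻¹) ^ (i : ℕ)) {a : Matrix (Fin 4) (Fin 4) ℚ}
    (ha : ∀ i j, a i j = Algebra.trace ℚ K ((ζ ^ 12 * (1 - ζ ^ 5) * (1 - ζ) * (ζ ^ 3 * (aeval ζ (derivative (cyclotomic 15 ℚ)))⁻¹)) * x i * IsCMField.complexConj K ((1 + 2 * ζ ^ 5) * x j))) :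
    a.det = 1296 := by
  rw [realPart_piThree_sqrtNegThree hζ hx ha]
  simp [Matrix.det_succ_row_zero, Fin.sum_univ_succ, Fin.succAbove, Matrix.submatrix]
  norm_num

/-! ### §3 Every parameter of the type gives the same determinant -/

/-- **For EVERY skew `ζ′` of type `𝔮₅` on `ℤ[ζ₁₅]` (`IsOfType 1 ζ′ 𝔣₀`, `𝔬𝔣₀ = (π)`, `(𝔬𝔣₀)⁴ = (5)`; `ζ′ = u·πξ`,
`u` a real unit of norm `1` by THEOREM L (i) at `15`) the Gram determinant of `(E_ζ′, s₃)` in the frame `θ^i` is `720`**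
— for every `Φ` and every `Φ`-positive such `ζ′` (they exist for every `₃`… balanced `Φ`, part 80): class `[5]`, `T(5) = {3, 5}`: the NON-SPLIT row `W4.3.5 = (2, ℚ(√−3), 5)`.
research route conditional on HC_CM; not a corollary; Q11.4-sentence-2 already refuted in dim ≥ 3. [cite: vanGeemen1994HodgeAV, Lemma 5.2 (3) and (5.4.1)] [cite: Shimura1998, §14.3 Prop. 4–5, pp. 103–104] -/
theorem det_realPart_typeFive_sqrtNegThree [IsCyclotomicExtension {15} ℚ K] [IsCMField K]
    (hζ : IsPrimitiveRoot ζ 15) {𝔣₀ : Ideal (𝓞 (maximalRealSubfield K))}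
    (h𝔣₀ : 𝔣₀.map (algebraMap (𝓞 (maximalRealSubfield K)) (𝓞 K)) = Ideal.span {hζ.toInteger ^ 13 * (1 - hζ.toInteger ^ 3) * (1 - hζ.toInteger ^ 1)})
    {ζ' : K} (hζ' : IsCMField.complexConj K ζ' = -ζ')
    (hT : CMTypeLattice.IsOfType (1 : (FractionalIdeal (𝓞 K)⁰ K)ˣ) ζ' 𝔣₀)
    {x : Fin 4 → K} (hx : ∀ i, x i = (ζ + ζ⁻¹) ^ (i : ℕ)) {a : Matrix (Fin 4) (Fin 4) ℚ}
    (ha : ∀ i j, a i j = Algebra.trace ℚ K (ζ' * x i * IsCMField.complexConj K ((1 + 2 * ζ ^ 5) * x j))) :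
    a.det = 720 := by
  obtain ⟨ωb, hωb⟩ := exists_basis_thetaPow hζ
  have hx' : ∀ i, x i = (ωb i : K) := fun i => (hx i).trans (hωb i).symm
  have hg : Nat.totient 15 = 2 * (3 + 1) := by rw [totient_fifteen]
  have hsk : IsCMField.complexConj K (ζ ^ 13 * (1 - ζ ^ 3) * (1 - ζ) * (ζ ^ 3 * (aeval ζ (derivative (cyclotomic 15 ℚ)))⁻¹)) =
      -(ζ ^ 13 * (1 - ζ ^ 3) * (1 - ζ) * (ζ ^ 3 * (aeval ζ (derivative (cyclotomic 15 ℚ)))⁻¹)) := by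
    simpa only [pow_one] using complexConj_gen_mul_xi hζ hg adm_fifteen_five
  have h0 : (ζ ^ 13 * (1 - ζ ^ 3) * (1 - ζ) * (ζ ^ 3 * (aeval ζ (derivative (cyclotomic 15 ℚ)))⁻¹)) ≠ 0 :=
    mul_ne_zero (by simpa only [pow_one] using gen_ne_zero hζ adm_fifteen_five) (xi_ne_zero hζ 3)
  have hT₀ : CMTypeLattice.IsOfType (1 : (FractionalIdeal (𝓞 K)⁰ K)ˣ) (ζ ^ 13 * (1 - ζ ^ 3) * (1 - ζ) * (ζ ^ 3 * (aeval ζ (derivative (cyclotomic 15 ℚ)))⁻¹)) 𝔣₀ := by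
    simpa only [pow_one] using isOfType_one_gen_mul_xi hζ 3 ((3, 1, 13) : ℕ × ℕ × ℕ) h𝔣₀
  rw [det_realPart_eq_of_isOfType ωb (complexConj_sqrtNegThree hζ) hx' (norm_realUnits_pos_fifteen hζ)
    hsk h0 hζ' hT₀ hT (fun i j => rfl) ha]
  exact det_realPart_piFive_sqrtNegThree hζ hx (fun i j => rfl)

/-- **For EVERY skew `ζ′` of type `𝔮₃` on `ℤ[ζ₁₅]` (`IsOfType 1 ζ′ 𝔣₀`, `𝔬𝔣₀ = (π)`, `(𝔬𝔣₀)² = (3)`; `ζ′ = u·πξ`,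
`u` a real unit of norm `1` by THEOREM L (i) at `15`) the Gram determinant of `(E_ζ′, s₃)` in the frame `θ^i` is `1296`**
— for every `Φ` and every `Φ`-positive such `ζ′` (they exist for every `₃`… balanced `Φ`, part 80): class `[1]`: the SPLIT row `W4.3.1`.
research route conditional on HC_CM; not a corollary; Q11.4-sentence-2 already refuted in dim ≥ 3. [cite: vanGeemen1994HodgeAV, Lemma 5.2 (3) and (5.4.1)] [cite: Shimura1998, §14.3 Prop. 4–5, pp. 103–104] -/
theorem det_realPart_typeThree_sqrtNegThree [IsCyclotomicExtension {15} ℚ K] [IsCMField K]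
    (hζ : IsPrimitiveRoot ζ 15) {𝔣₀ : Ideal (𝓞 (maximalRealSubfield K))}
    (h𝔣₀ : 𝔣₀.map (algebraMap (𝓞 (maximalRealSubfield K)) (𝓞 K)) = Ideal.span {hζ.toInteger ^ 12 * (1 - hζ.toInteger ^ 5) * (1 - hζ.toInteger ^ 1)})
    {ζ' : K} (hζ' : IsCMField.complexConj K ζ' = -ζ')
    (hT : CMTypeLattice.IsOfType (1 : (FractionalIdeal (𝓞 K)⁰ K)ˣ) ζ' 𝔣₀)
    {x : Fin 4 → K} (hx : ∀ i, x i = (ζ + ζ⁻¹) ^ (i : ℕ)) {a : Matrix (Fin 4) (Fin 4) ℚ}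
    (ha : ∀ i j, a i j = Algebra.trace ℚ K (ζ' * x i * IsCMField.complexConj K ((1 + 2 * ζ ^ 5) * x j))) :
    a.det = 1296 := by
  obtain ⟨ωb, hωb⟩ := exists_basis_thetaPow hζ
  have hx' : ∀ i, x i = (ωb i : K) := fun i => (hx i).trans (hωb i).symm
  have hg : Nat.totient 15 = 2 * (3 + 1) := by rw [totient_fifteen]
  have hsk : IsCMField.complexConj K (ζ ^ 12 * (1 - ζ ^ 5) * (1 - ζ) * (ζ ^ 3 * (aeval ζ (derivative (cyclotomic 15 ℚ)))⁻¹)) =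
      -(ζ ^ 12 * (1 - ζ ^ 5) * (1 - ζ) * (ζ ^ 3 * (aeval ζ (derivative (cyclotomic 15 ℚ)))⁻¹)) := by
    simpa only [pow_one] using complexConj_gen_mul_xi hζ hg adm_fifteen_three
  have h0 : (ζ ^ 12 * (1 - ζ ^ 5) * (1 - ζ) * (ζ ^ 3 * (aeval ζ (derivative (cyclotomic 15 ℚ)))⁻¹)) ≠ 0 :=
    mul_ne_zero (by simpa only [pow_one] using gen_ne_zero hζ adm_fifteen_three) (xi_ne_zero hζ 3)
  have hT₀ : CMTypeLattice.IsOfType (1 : (FractionalIdeal (𝓞 K)⁰ K)ˣ) (ζ ^ 12 * (1 - ζ ^ 5) * (1 - ζ) * (ζ ^ 3 * (aeval ζ (derivative (cyclotomic 15 ℚ)))⁻¹)) 𝔣₀ := by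
    simpa only [pow_one] using isOfType_one_gen_mul_xi hζ 3 ((5, 1, 12) : ℕ × ℕ × ℕ) h𝔣₀
  rw [det_realPart_eq_of_isOfType ωb (complexConj_sqrtNegThree hζ) hx' (norm_realUnits_pos_fifteen hζ)
    hsk h0 hζ' hT₀ hT (fun i j => rfl) ha]
  exact det_realPart_piThree_sqrtNegThree hζ hx (fun i j => rfl)

/-! ### §4 Classes: `[720] = [5]` NON-SPLIT, `[1296] = [1]` SPLIT -/

/-- **`[720] = [5] ≠ [1]` in `ℚˣ/Nm(ℚ(√−3)ˣ)`** (`720 = 5·12²`; `5` is inert):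
the type-`𝔮₅` polarised Weil-type `ℤ[ζ₁₅]`-fourfolds lie on the NON-SPLIT component — class `[5]`, `T(5) = {3, 5}`: the NON-SPLIT row `W4.3.5 = (2, ℚ(√−3), 5)`.
research route conditional on HC_CM; not a corollary; Q11.4-sentence-2 already refuted in dim ≥ 3. [cite: vanGeemen1994HodgeAV, 5.4 and (5.4.1)] [cite: Serre1973, Ch. III §1] -/
theorem mk0_det_typeFive_sqrtNegThree :
    (QuotientGroup.mk (Units.mk0 (720 : ℚ) (by norm_num)) : weilNormResidueGroup 3) =
        QuotientGroup.mk (Units.mk0 (5 : ℚ) (by norm_num)) ∧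
      (QuotientGroup.mk (Units.mk0 (5 : ℚ) (by norm_num)) : weilNormResidueGroup 3) ≠
        splitDiscriminantClass 2 3 := by
  constructor
  · rw [QuotientGroup.eq]
    have e : (Units.mk0 (720 : ℚ) (by norm_num))⁻¹ * Units.mk0 (5 : ℚ) (by norm_num) =
        Units.mk0 ((1 / 144) : ℚ) (by norm_num) := Units.ext (by norm_num)
    rw [e]
    exact mem_normUnitsSubgroup_of_sq_add_mul_sq _ ((1 / 12) : ℚ) 0 (by norm_num)
  · refine mk_ne_split_of_even (by decide) _ ?_
    have h := natCast_not_mem_normUnitsSubgroup_of_inert (d := 3) (a := 5) (p := 5) (by norm_num) (by decide)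
      (dvd_refl 5) (by norm_num) (by norm_num)
    simpa using h

/-- **`[1296] = [1]`, the SPLIT class, in `ℚˣ/Nm(ℚ(√−3)ˣ)`** (`1296 = 36²`): the type-`𝔮₃` (degree `9`)
polarised Weil-type `ℤ[ζ₁₅]`-fourfolds lie on the SPLIT component — class `[1]`: the SPLIT row `W4.3.1`.
research route conditional on HC_CM; not a corollary; Q11.4-sentence-2 already refuted in dim ≥ 3. [cite: vanGeemen1994HodgeAV, 5.4 and (5.4.1)] -/
theorem mk0_det_typeThree_sqrtNegThree :
    (QuotientGroup.mk (Units.mk0 (1296 : ℚ) (by norm_num)) : weilNormResidueGroup 3) =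
      splitDiscriminantClass 2 3 :=
  mk_eq_split_of_even (by decide) _ (mem_normUnitsSubgroup_of_sq_add_mul_sq _ (36 : ℚ) 0 (by norm_num))

end Summit.HodgeConjecture.Ring2WeilCoverage.WeilGramLevel15TypesSqrtNegThree

end
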